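import Summits.Ventures.PercRepro.C041MultiExitCoincident
import Summits.Ventures.PercRepro.C041PendantCone

/-!
# ROW C-041 — THE CONE AND THE ZONE O-CUBE FOR A FAMILY OF ZONES HUNG AT ONE VERTEX (p6, gen 33; THEOREM
(PENDANT ZONE) of `C041PendantCone` for `r` zones at once, on the multi-exit attachment)

Setting of `C041MultiExitCoincident`.  The one-exit block map of a host `Z₁` at a vertex `v`, read by the four
classes of colourings (merged / reached), is `z·w + x·θ_B w + y·θ_R w + w₀·θ_R(θ_B w)` (`sum_oneExit`; `xCount`,
`yCount`, `zCount`, `wCount` of `C041PendantSix`), and with `x = y` (the complementation symmetry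
`xCount_eq_yCount`) and `θ_R(θ_B w) = n(w)·𝟙` the six-vector of ONE zone hung at `v` is
`x·ℓ(ψΠ) + z·Π + w₀·n·𝟙` (`sixVec_hang_unit`: THEOREM (PENDANT ZONE) in the `Σ`-typed attachment), which lies in
the cone when `Π` does (`inCone_sixVec_hang_unit`).  Hence, by `sixVec_hang_const_eq` and the anchor product,
**the six-vector of a family of cone zones hung at one vertex of any unmarked multigraph lies in the cone**
(`inCone_sixVec_hang_const`), and the ZONE O-CUBE holds there (`zoneOCubeConj_hang_const`).
-/

namespace PercRepro

namespace ZoneZ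

namespace MultiExit

open ZoneData Pendant Finset TwoExit TreeClosure

/-! ## `θ_R ∘ θ_B`, and `ℓ` of a six-vector -/

/-- `θ_R (θ_B w) = n(w) · 𝟙`. -/
theorem thR_thB (w : Vec6) : thR (thB w) = nAdm w • (1 : Vec6) := by
  funext i
  fin_cases i <;> simp [thR, thB, nAdm, kInv]

section OneZoneVec

variable {V E T₁ T₂ : Type} (Z : ZoneData V E T₁ T₂) (a : V) [Fintype E] [DecidableEq E] [Fintype T₁]
  [DecidableEq T₁] [Fintype T₂] [DecidableEq T₂]

/-- `ℓ` of the six-vector is `ℓ(F, T₁, T₂, I)`. -/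
theorem ellv_sixVec :
    ellv (Z.sixVec a) = ell (#(Z.Fset a)) (#(Z.T1set a)) (#(Z.T2set a)) (#(Z.Iset a)) := by
  unfold ellv
  rw [sixVec_zero, sixVec_one, sixVec_two, sixVec_three, sixVec_four, sixVec_five]
  have hA : (#(Z.FAset a) : ℝ) - #(Z.Fset a) = #(Z.T1set a) := by
    rw [Z.card_FAset a]
    push_cast
    ring
  have hB : (#(Z.FBset a) : ℝ) - #(Z.Fset a) = #(Z.T2set a) := by
    rw [Z.card_FBset a]
    push_cast
    ring
  have hI : (#(Z.IAset a) : ℝ) + #(Z.IBset a) - #(Z.IFset a) = #(Z.Iset a) := by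
    have h := Z.card_Iset_add_IFset a
    have h' : ((#(Z.Iset a) + #(Z.IFset a) : ℕ) : ℝ) = ((#(Z.IAset a) + #(Z.IBset a) : ℕ) : ℝ) := by rw [h]
    push_cast at h'
    linarith
  rw [hA, hB, hI]

/-- `n` of the six-vector is the admissible count. -/
theorem nAdm_sixVec : nAdm (Z.sixVec a) = #(Z.Aset (∅ : Set V)) := by
  unfold nAdm
  rw [sixVec_zero, sixVec_one, sixVec_two]
  have := card_FAset_add_card_FBset Z a
  have h' : ((#(Z.FAset a) + #(Z.FBset a) : ℕ) : ℝ) = ((#(Z.Aset (∅ : Set V)) + #(Z.Fset a) : ℕ) : ℝ) := by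
    rw [this]
  push_cast at h'
  linarith

/-- `ℓ` of a cone six-vector lies in the cone. -/
theorem inCone_ellv_sixVec (h : InCone (Z.sixVec a)) : InCone (ellv (Z.sixVec a)) := by
  rw [ellv_sixVec]
  have := InCone_one.mul_ell (Z.K4_of_inCone_sixVec a h)
  rwa [one_mul] at this

end OneZoneVec

/-! ## The one-exit block map by the four classes -/

section OneExit

variable {V₁ E₁ U₁ U₂ : Type} (Z₁ : ZoneData V₁ E₁ U₁ U₂) (v a₁ : V₁) [Fintype E₁] [DecidableEq E₁]

open Classical in
/-- The one-exit block map at `v`, by the four classes of colourings (merged / reached). -/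
theorem sum_oneExit (w : Vec6) :
    (∑ ω : E₁ → Bool, if Z₁.Mg a₁ v ω then exitOf w (Z₁.Rd a₁ v ω) else thR (exitOf w (Z₁.Rd a₁ v ω))) =
      (zCount Z₁ v a₁ : ℝ) • w + (xCount Z₁ v a₁ : ℝ) • thB w + (yCount Z₁ v a₁ : ℝ) • thR w +
        (wCount Z₁ v a₁ : ℝ) • thR (thB w) := by
  have e : ∀ ω : E₁ → Bool,
      (if Z₁.Mg a₁ v ω then exitOf w (Z₁.Rd a₁ v ω) else thR (exitOf w (Z₁.Rd a₁ v ω))) =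
        (if Z₁.Mg a₁ v ω ∧ Z₁.Rd a₁ v ω then w else 0) + (if Z₁.Mg a₁ v ω ∧ ¬ Z₁.Rd a₁ v ω then thB w else 0) +
          (if ¬ Z₁.Mg a₁ v ω ∧ Z₁.Rd a₁ v ω then thR w else 0) +
          (if ¬ Z₁.Mg a₁ v ω ∧ ¬ Z₁.Rd a₁ v ω then thR (thB w) else 0) := by
    intro ω
    unfold exitOf
    by_cases hm : Z₁.Mg a₁ v ω <;> by_cases hr : Z₁.Rd a₁ v ω <;> simp [hm, hr]
  rw [Finset.sum_congr rfl fun ω _ => e ω, Finset.sum_add_distrib, Finset.sum_add_distrib,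
    Finset.sum_add_distrib, ← Finset.sum_filter, ← Finset.sum_filter, ← Finset.sum_filter, ← Finset.sum_filter,
    Finset.sum_const, Finset.sum_const, Finset.sum_const, Finset.sum_const, ← Nat.cast_smul_eq_nsmul ℝ,
    ← Nat.cast_smul_eq_nsmul ℝ, ← Nat.cast_smul_eq_nsmul ℝ, ← Nat.cast_smul_eq_nsmul ℝ]
  unfold zCount xCount yCount wCount
  congr 2

end OneExit

/-! ## One zone at a vertex: THEOREM (PENDANT ZONE) on the multi-exit attachment -/

section OneZone

variable {V₁ E₁ U₁ U₂ V E T₁ T₂ : Type} (Z₁ : ZoneData V₁ E₁ U₁ U₂) (v a₁ : V₁) (Z : ZoneData V E T₁ T₂) (a : V)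
variable [Fintype E₁] [DecidableEq E₁] [Fintype E] [DecidableEq E] [Fintype T₁] [DecidableEq T₁] [Fintype T₂]
  [DecidableEq T₂]

/-- **THEOREM (PENDANT ZONE) on the multi-exit attachment**: the six-vector of one zone hung at `v` is
`x·ℓ(ψΠ) + z·Π + w₀·n·𝟙`. -/
theorem sixVec_hang_unit :
    (hang Z₁ (fun _ : Unit => v) (fun _ => Z) (fun _ => a)).sixVec (Sum.inl a₁) =
      (xCount Z₁ v a₁ : ℝ) • ell (#(Z.Fset a)) (#(Z.T1set a)) (#(Z.T2set a)) (#(Z.Iset a)) +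
        (zCount Z₁ v a₁ : ℝ) • Z.sixVec a + ((wCount Z₁ v a₁ : ℝ) * #(Z.Aset (∅ : Set V))) • (1 : Vec6) := by
  have h1 : (xCount Z₁ v a₁ : ℝ) • thB (Z.sixVec a) + (xCount Z₁ v a₁ : ℝ) • thR (Z.sixVec a) =
      (xCount Z₁ v a₁ : ℝ) • ell (#(Z.Fset a)) (#(Z.T1set a)) (#(Z.T2set a)) (#(Z.Iset a)) := by
    rw [← smul_add, thB_add_thR, ellv_sixVec]
  rw [sixVec_hang_const, Fintype.prod_unique, sum_oneExit, ← xCount_eq_yCount, thR_thB, nAdm_sixVec, smul_smul,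
    add_assoc ((zCount Z₁ v a₁ : ℝ) • Z.sixVec a), h1]
  abel

/-- **The cone is closed under hanging one zone at a vertex** (multi-exit form). -/
theorem inCone_sixVec_hang_unit (h : InCone (Z.sixVec a)) :
    InCone ((hang Z₁ (fun _ : Unit => v) (fun _ => Z) (fun _ => a)).sixVec (Sum.inl a₁)) := by
  rw [sixVec_hang_unit]
  have hℓ := inCone_ellv_sixVec Z a h
  rw [ellv_sixVec] at hℓ
  exact InCone.add (InCone.add (InCone.smul _ (Nat.cast_nonneg _) hℓ) (InCone.smul _ (Nat.cast_nonneg _) h))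
    (InCone.smul _ (mul_nonneg (Nat.cast_nonneg _) (Nat.cast_nonneg _)) InCone_one)

end OneZone

/-! ## A family of cone zones at one vertex -/

/-- A finite product of cone vectors lies in the cone. -/
theorem inCone_prod {κ : Type} (s : Finset κ) (w : κ → Vec6) (h : ∀ k ∈ s, InCone (w k)) :
    InCone (∏ k ∈ s, w k) :=
  Finset.prod_induction w InCone (fun _ _ ha hb => InCone.mul ha hb) InCone_one h

variable {ι : Type} [Fintype ι] [DecidableEq ι] {V E T₁ T₂ : ι → Type}
  (Z : (k : ι) → ZoneData (V k) (E k) (T₁ k) (T₂ k)) (a : (k : ι) → V k)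
  [∀ k, Fintype (E k)] [∀ k, DecidableEq (E k)] [∀ k, Fintype (T₁ k)] [∀ k, DecidableEq (T₁ k)]
  [∀ k, Fintype (T₂ k)] [∀ k, DecidableEq (T₂ k)]
  {V₁ E₁ U₁ U₂ : Type} (Z₁ : ZoneData V₁ E₁ U₁ U₂) (v a₁ : V₁) [Fintype E₁] [DecidableEq E₁]

/-- **The six-vector of a family of cone zones hung at one vertex of any unmarked multigraph lies in the cone.** -/
theorem inCone_sixVec_hang_const [Nonempty ι] (h : ∀ k, InCone ((Z k).sixVec (a k))) :
    InCone ((hang Z₁ (fun _ : ι => v) Z a).sixVec (Sum.inl a₁)) := by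
  rw [sixVec_hang_const_eq]
  refine inCone_sixVec_hang_unit Z₁ v a₁ _ _ ?_
  rw [sixVec_hang_vertex]
  exact inCone_prod _ _ fun k _ => h k

/-- **THE ZONE O-CUBE for a family of cone zones hung at one vertex of any unmarked multigraph.** -/
theorem zoneOCubeConj_hang_const [Nonempty ι] (h : ∀ k, InCone ((Z k).sixVec (a k))) :
    (hang Z₁ (fun _ : ι => v) Z a).ZoneOCubeConj {Sum.inl a₁} (∅ : Set (V₁ ⊕ (Σ k, V k))) :=
  (hang Z₁ (fun _ : ι => v) Z a).zoneOCubeConj_of_inCone_sixVec (Sum.inl a₁)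
    (inCone_sixVec_hang_const Z a Z₁ v a₁ h)

end MultiExit

end ZoneZ

end PercRepro
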